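import Mathlib
import HarnessLib
import Literature.Probability.Percolation.PercolationEvents
import Literature.Probability.LatticeModels.DomainDiscretisation

/-!
# First jets at `1` of ratios of configuration polynomials; Russo's formula at `p = 1/2` in
finite volume (toolkit for route CardyQContinuation, item stmt-CriticalPhenomena-7129)

For a finite set `E` of coordinates, an increasing event `C` on its subsets and natural exponents
`L(ω)`, the ratio `P(z) = Σ_{ω ⊆ E, ω ∈ C} z^{L(ω)} / Σ_{ω ⊆ E} z^{L(ω)}` is an exponential family
in `log z` read at the uniform point `z = 1`, so `P′(1) = Cov_unif(1_C, L)`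
(`deriv_sum_mul_pow_div_sum_pow_one`). For `L = |ω|` Russo's formula at `p = 1/2` turns the
covariance into a quarter of the mean number of pivotal coordinates
(`sum_powerset_ite_mem_mul_eq_half_sum_ncard_pivotals`, proved by toggling one coordinate), whence

* `deriv_ratio_indicator_pow_ncard_one`: `d/dt|₁ Σ_C t^|ω| / Σ t^|ω| = Σ_ω N_piv(ω) / (4·2^|E|)`;
* `deriv_ratio_indicator_pow_ncard_add_one`: with exponent `|ω| + 2k(ω)`,
  `d/ds|₁ = ¼ E[N_piv] + 2 Cov(1_C, k)`.

Everything is stated with `finsum` over `𝒫 ↑E` to match the route file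
`Summits/CriticalPhenomena/CardyFormulaZ2/Theses/CardyQContinuation.lean`; pivotality is the
tree's `Literature.Probability.Percolation.IsPivotal` / `pivotals` (`PercolationEvents.lean`).
Sources: Russo 1981; Grimmett, *Percolation* (1999) Thm. 2.25; Grimmett, *The random-cluster
model* (2006) Thm. 3.12.
-/

namespace Summit.CriticalPhenomena.CardyFormulaZ2.Theorems

open Filter Topology Finset

/-- Derivative of a finite sum of monomials `z ↦ Σ_i a_i z^(L_i)`. [folklore] -/
theorem hasDerivAt_sum_mul_pow {ι : Type*} (S : Finset ι) (a : ι → ℂ) (L : ι → ℕ) (s : ℂ) :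
    HasDerivAt (fun z : ℂ ↦ ∑ i ∈ S, a i * z ^ (L i))
      (∑ i ∈ S, a i * ((L i : ℂ) * s ^ (L i - 1))) s := by
  apply HasDerivAt.fun_sum
  intro i _
  exact (hasDerivAt_pow (L i) s).const_mul (a i)

/-- **First jet at `1` of a ratio of configuration polynomials.** For a nonempty finite index set
`S`, natural exponents `L` and coefficients `a`,
`d/dz|_{z=1} (Σ a_i z^(L_i)) / (Σ z^(L_i)) = ((Σ a_i L_i)·|S| − (Σ a_i)(Σ L_i)) / |S|²`,
i.e. the covariance of `a` and `L` under the uniform measure on `S` (an exponential family in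
`log z` evaluated at the uniform point). [folklore] -/
theorem deriv_sum_mul_pow_div_sum_pow_one {ι : Type*} (S : Finset ι) (hS : S.Nonempty)
    (a : ι → ℂ) (L : ι → ℕ) :
    deriv (fun z : ℂ ↦ (∑ i ∈ S, a i * z ^ (L i)) / (∑ i ∈ S, z ^ (L i))) 1
      = ((∑ i ∈ S, a i * (L i : ℂ)) * (S.card : ℂ) - (∑ i ∈ S, a i) * (∑ i ∈ S, (L i : ℂ)))
          / (S.card : ℂ) ^ 2 := by
  have hnum : HasDerivAt (fun z : ℂ ↦ ∑ i ∈ S, a i * z ^ (L i)) (∑ i ∈ S, a i * (L i : ℂ)) 1 := by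
    have := hasDerivAt_sum_mul_pow S a L 1
    simpa using this
  have hden : HasDerivAt (fun z : ℂ ↦ ∑ i ∈ S, z ^ (L i)) (∑ i ∈ S, (L i : ℂ)) 1 := by
    have := hasDerivAt_sum_mul_pow S (fun _ ↦ 1) L 1
    simpa using this
  have hden1 : (∑ i ∈ S, (1 : ℂ) ^ (L i)) = S.card := by simp
  have hne : (∑ i ∈ S, (1 : ℂ) ^ (L i)) ≠ 0 := by
    rw [hden1]; exact_mod_cast hS.card_pos.ne'
  rw [(hnum.fun_div hden hne).deriv]
  simp only [one_pow, mul_one, Finset.sum_const, nsmul_eq_mul]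


/-! ### Finite sums over the powerset of a finite set -/

/-- For a `Finset` `E`, the finsum of `f` over the powerset `𝒫 ↑E` is the `Finset` sum of
`f ∘ (↑)` over `E.powerset`. [folklore] -/
theorem finsum_mem_powerset_coe_eq_sum {α M : Type*} [AddCommMonoid M] [DecidableEq α]
    (E : Finset α) (f : Set α → M) :
    ∑ᶠ ω ∈ 𝒫 (↑E : Set α), f ω = ∑ F ∈ E.powerset, f ↑F := by
  have hfin : (𝒫 (↑E : Set α)).Finite := E.finite_toSet.finite_subsets
  rw [finsum_mem_eq_finite_toFinset_sum f hfin]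
  have himg : hfin.toFinset = E.powerset.image (fun F : Finset α ↦ (↑F : Set α)) := by
    ext ω
    simp only [Set.Finite.mem_toFinset, Set.mem_powerset_iff, Finset.mem_image,
      Finset.mem_powerset]
    constructor
    · intro h
      have hω : ω.Finite := E.finite_toSet.subset h
      refine ⟨hω.toFinset, ?_, hω.coe_toFinset⟩
      intro x hx
      exact h (hω.mem_toFinset.1 hx)
    · rintro ⟨F, hF, rfl⟩
      exact Finset.coe_subset.2 hF
  rw [himg, Finset.sum_image fun F _ G _ h ↦ Finset.coe_injective h]

/-- The edge set of the discrete domain `Ω_δ` of a bounded domain is finite for `δ > 0`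
(both endpoints of an edge lie in the finite set `meshDomain Ω δ`). [folklore] -/
theorem finite_edgeSet_discreteDomainGraph {Ω : Set ℂ} {δ : ℝ} (hΩ : Bornology.IsBounded Ω)
    (hδ : 0 < δ) : (Literature.Probability.LatticeModels.discreteDomainGraph Ω δ).edgeSet.Finite := by
  have hfin := Literature.Probability.LatticeModels.meshDomain_finite hΩ hδ
  refine ((hfin.prod hfin).image
    (fun p : Literature.Probability.LatticeModels.Site 2 × Literature.Probability.LatticeModels.Site 2 ↦
      s(p.1, p.2))).subset ?_
  intro e he
  induction e using Sym2.ind with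
  | h x y =>
    rw [SimpleGraph.mem_edgeSet, Literature.Probability.LatticeModels.discreteDomainGraph_adj_iff] at he
    exact ⟨(x, y), ⟨he.2.1, he.2.2⟩, rfl⟩

/-! ### Toggling one coordinate: Russo's formula at `p = 1/2` in finite volume -/

section Toggle

open scoped Classical

variable {α : Type*} [DecidableEq α]

/-- Splitting a sum over `E.powerset` according to whether a fixed `e ∈ E` belongs to the
subset: `Σ_{F ⊆ E} g F = Σ_{F ⊆ E ∖ e} (g F + g (F ∪ {e}))`. [folklore] -/
theorem sum_powerset_eq_sum_powerset_erase_add {M : Type*} [AddCommMonoid M] {E : Finset α}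
    {e : α} (he : e ∈ E) (g : Finset α → M) :
    ∑ F ∈ E.powerset, g F = ∑ F ∈ (E.erase e).powerset, (g F + g (insert e F)) := by
  conv_lhs => rw [← Finset.insert_erase he]
  rw [Finset.sum_powerset_insert (Finset.notMem_erase e E), Finset.sum_add_distrib]

/-- For an increasing event and `e ∉ F`: `1_C(F ∪ {e}) − 1_C(F) = 1[e pivotal at F]`. [folklore] -/
theorem ite_mem_insert_sub_ite_mem_eq_ite_isPivotal {C : Set (Set α)} (hC : IsUpperSet C) {e : α} {F : Finset α}
    (he : e ∉ F) : (if (↑(insert e F) : Set α) ∈ C then (1 : ℂ) else 0) - (if (↑F : Set α) ∈ C then (1 : ℂ) else 0) = (if Literature.Probability.Percolation.IsPivotal C e (↑F : Set α) then (1 : ℂ) else 0) := by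
  unfold Literature.Probability.Percolation.IsPivotal
  have hsd : (↑F : Set α) \ {e} = ↑F := by
    rw [sdiff_eq_left, Set.disjoint_singleton_right]; exact_mod_cast he
  rw [Finset.coe_insert, hsd]
  by_cases h1 : (↑F : Set α) ∈ C
  · have h2 : insert e (↑F : Set α) ∈ C := hC (Set.subset_insert e _) h1
    simp [h1, h2]
  · by_cases h2 : insert e (↑F : Set α) ∈ C
    · simp [h1, h2]
    · simp [h1, h2]

/-- **Russo at `p = 1/2`, one edge** (finite volume, counting form): for an increasing event `C`
and `e ∈ E`, `Σ_{F ⊆ E} 1_C(F)·(±1 according as e ∈ F) = ½ Σ_{F ⊆ E} 1[e pivotal for C at F]`.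
[folklore] -/
theorem sum_powerset_ite_mem_mul_sign_eq {C : Set (Set α)} (hC : IsUpperSet C)
    {E : Finset α} {e : α} (he : e ∈ E) :
    ∑ F ∈ E.powerset, (if (↑F : Set α) ∈ C then (1 : ℂ) else 0) * (if e ∈ F then 1 else -1)
      = (1 / 2 : ℂ) * ∑ F ∈ E.powerset, (if Literature.Probability.Percolation.IsPivotal C e (↑F : Set α) then (1 : ℂ) else 0) := by
  rw [sum_powerset_eq_sum_powerset_erase_add he, sum_powerset_eq_sum_powerset_erase_add he,
    Finset.mul_sum]
  refine Finset.sum_congr rfl fun F hF ↦ ?_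
  have heF : e ∉ F := fun h ↦ Finset.notMem_erase e E (Finset.mem_powerset.1 hF h)
  rw [Finset.coe_insert, Literature.Probability.Percolation.isPivotal_insert_iff,
    ← Finset.coe_insert, ← ite_mem_insert_sub_ite_mem_eq_ite_isPivotal hC heF]
  simp [heF]
  ring

/-- For `F ⊆ E`: `Σ_{e ∈ E} (±1 according as e ∈ F) = 2|F| − |E|`. [folklore] -/
theorem sum_sign_eq {E F : Finset α} (hF : F ⊆ E) :
    ∑ e ∈ E, (if e ∈ F then (1 : ℂ) else -1) = 2 * (F.card : ℂ) - (E.card : ℂ) := by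
  rw [Finset.sum_ite, Finset.sum_const, Finset.sum_const, Finset.filter_mem_eq_inter,
    Finset.inter_eq_right.2 hF]
  have h := Finset.card_filter_add_card_filter_not (s := E) (fun e ↦ e ∈ F)
  rw [Finset.filter_mem_eq_inter, Finset.inter_eq_right.2 hF] at h
  have h' : ((Finset.filter (fun e ↦ e ∉ F) E).card : ℂ) = E.card - F.card := by
    have := congrArg (fun n : ℕ ↦ (n : ℂ)) h
    push_cast at this
    linear_combination this
  simp only [nsmul_eq_mul, h']
  ring

omit [DecidableEq α] in
/-- The number of pivotal coordinates in `E` as a sum of indicators. [folklore] -/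
theorem sum_ite_isPivotal_eq_ncard_pivotals (C : Set (Set α)) (E F : Finset α) :
    ∑ e ∈ E, (if Literature.Probability.Percolation.IsPivotal C e (↑F : Set α) then (1 : ℂ) else 0)
      = ((Literature.Probability.Percolation.pivotals C (↑F : Set α) ∩ ↑E).ncard : ℂ) := by
  rw [Finset.sum_boole]
  congr 1
  rw [← Set.ncard_coe_finset]
  congr 1
  ext e
  simp [Literature.Probability.Percolation.mem_pivotals, and_comm]

/-- **Russo at `p = 1/2`** (finite volume, counting form): for an increasing event `C` on the
subsets of a finite set `E`,
`Σ_{F ⊆ E} 1_C(F)·(2|F| − |E|) = ½ Σ_{F ⊆ E} #{e ∈ E pivotal for C at F}`;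
dividing by `2^|E|` this is `Cov_{1/2}(1_C, |ω|) = ¼ E_{1/2}[N_piv]`.
(Russo 1981; Grimmett 1999, Thm. 2.25, at `p = 1/2`.) [folklore] -/
theorem sum_powerset_ite_mem_mul_eq_half_sum_ncard_pivotals {C : Set (Set α)} (hC : IsUpperSet C)
    (E : Finset α) :
    ∑ F ∈ E.powerset, (if (↑F : Set α) ∈ C then (1 : ℂ) else 0) * (2 * (F.card : ℂ) - (E.card : ℂ))
      = (1 / 2 : ℂ) * ∑ F ∈ E.powerset,
          ((Literature.Probability.Percolation.pivotals C (↑F : Set α) ∩ ↑E).ncard : ℂ) := by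
  have h1 : ∀ F ∈ E.powerset, (if (↑F : Set α) ∈ C then (1 : ℂ) else 0) * (2 * (F.card : ℂ) - (E.card : ℂ))
      = ∑ e ∈ E, (if (↑F : Set α) ∈ C then (1 : ℂ) else 0) * (if e ∈ F then 1 else -1) := fun F hF ↦ by
    rw [← Finset.mul_sum, sum_sign_eq (Finset.mem_powerset.1 hF)]
  rw [Finset.sum_congr rfl h1, Finset.sum_comm]
  simp_rw [← sum_ite_isPivotal_eq_ncard_pivotals C E]
  rw [Finset.sum_comm (s := E.powerset), Finset.mul_sum]
  exact Finset.sum_congr rfl fun e he ↦ sum_powerset_ite_mem_mul_sign_eq hC he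

/-- `Σ_{F ⊆ E} (2|F| − |E|) = 0` (the average size of a subset is `|E|/2`). [folklore] -/
theorem sum_two_mul_card_sub_card (E : Finset α) :
    ∑ F ∈ E.powerset, (2 * (F.card : ℂ) - (E.card : ℂ)) = 0 := by
  have h := sum_powerset_ite_mem_mul_eq_half_sum_ncard_pivotals (C := (Set.univ : Set (Set α)))
    isUpperSet_univ E
  have hev : ∀ F : Finset α, (if (↑F : Set α) ∈ (Set.univ : Set (Set α)) then (1 : ℂ) else 0) = 1 := fun F ↦ by simp
  have hpiv : ∀ F : Finset α,
      Literature.Probability.Percolation.pivotals (Set.univ : Set (Set α)) (↑F : Set α) = ∅ := by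
    intro F
    ext e
    simp [Literature.Probability.Percolation.mem_pivotals, Literature.Probability.Percolation.IsPivotal]
  simpa [hev, hpiv] using h

end Toggle

/-! ### First jets at `1` of the Bernoulli and of the self-dual random-cluster crossing ratios -/

section Jets

open scoped Classical

variable {α : Type*} [DecidableEq α]

/-- **First `t`-jet at `t = 1` of the Bernoulli crossing ratio = `¼ E_{1/2}[N_piv]`** (finite
volume, counting form). For an increasing event `C` on the subsets of a finite set `E`,
`d/dt|_{t=1} (Σ_{ω ⊆ E, ω ∈ C} t^|ω|) / (Σ_{ω ⊆ E} t^|ω|) = (Σ_{ω ⊆ E} #{e ∈ E pivotal for C at ω}) / (4 · 2^|E|)`: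
the logarithmic derivative of the exponential family `t^|ω|` is the covariance
`Cov_{1/2}(1_C, |ω|)`, which Russo's formula at `p = 1/2` turns into a quarter of the mean
number of pivotal edges. (Russo 1981; Grimmett 1999 Thm. 2.25; Grimmett 2006 Thm. 3.12.)
[folklore] -/
theorem deriv_ratio_indicator_pow_ncard_one (E : Finset α) {C : Set (Set α)} (hC : IsUpperSet C) :
    deriv (fun t : ℂ ↦ (∑ᶠ ω ∈ 𝒫 (↑E : Set α), C.indicator (fun ω ↦ t ^ ω.ncard) ω) /
        (∑ᶠ ω ∈ 𝒫 (↑E : Set α), t ^ ω.ncard)) 1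
      = (∑ᶠ ω ∈ 𝒫 (↑E : Set α),
          ((Literature.Probability.Percolation.pivotals C ω ∩ ↑E).ncard : ℂ)) / (4 * 2 ^ E.card) := by
  have hfun : (fun t : ℂ ↦ (∑ᶠ ω ∈ 𝒫 (↑E : Set α), C.indicator (fun ω ↦ t ^ ω.ncard) ω) /
        (∑ᶠ ω ∈ 𝒫 (↑E : Set α), t ^ ω.ncard))
      = fun t : ℂ ↦ (∑ F ∈ E.powerset, (if (↑F : Set α) ∈ C then (1 : ℂ) else 0) * t ^ F.card) /
          (∑ F ∈ E.powerset, t ^ F.card) := by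
    funext t
    rw [finsum_mem_powerset_coe_eq_sum, finsum_mem_powerset_coe_eq_sum]
    congr 1
    · refine Finset.sum_congr rfl fun F _ ↦ ?_
      by_cases h : (↑F : Set α) ∈ C
      · simp [h, Set.ncard_coe_finset]
      · simp [h]
    · exact Finset.sum_congr rfl fun F _ ↦ by rw [Set.ncard_coe_finset]
  rw [hfun, deriv_sum_mul_pow_div_sum_pow_one E.powerset ⟨∅, Finset.empty_mem_powerset E⟩
    (fun F ↦ (if (↑F : Set α) ∈ C then (1 : ℂ) else 0)) Finset.card, finsum_mem_powerset_coe_eq_sum, Finset.card_powerset]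
  have hR := sum_powerset_ite_mem_mul_eq_half_sum_ncard_pivotals hC E
  have h0 := sum_two_mul_card_sub_card E
  have hR' : 2 * (∑ F ∈ E.powerset, (if (↑F : Set α) ∈ C then (1 : ℂ) else 0) * (F.card : ℂ))
      - (E.card : ℂ) * ∑ F ∈ E.powerset, (if (↑F : Set α) ∈ C then (1 : ℂ) else 0)
      = (1 / 2 : ℂ) * ∑ F ∈ E.powerset,
          ((Literature.Probability.Percolation.pivotals C (↑F : Set α) ∩ ↑E).ncard : ℂ) := by
    rw [← hR, Finset.mul_sum, Finset.mul_sum, ← Finset.sum_sub_distrib]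
    exact Finset.sum_congr rfl fun F _ ↦ by ring
  have h0' : 2 * (∑ F ∈ E.powerset, (F.card : ℂ)) - (E.card : ℂ) * (2 : ℂ) ^ E.card = 0 := by
    rw [← h0, Finset.sum_sub_distrib, Finset.sum_const, Finset.card_powerset, Finset.mul_sum,
      nsmul_eq_mul]
    push_cast
    ring
  push_cast
  set N : ℂ := (2 : ℂ) ^ E.card with hNdef
  set Sa : ℂ := ∑ F ∈ E.powerset, (if (↑F : Set α) ∈ C then (1 : ℂ) else 0)
  set SaL : ℂ := ∑ F ∈ E.powerset, (if (↑F : Set α) ∈ C then (1 : ℂ) else 0) * (F.card : ℂ)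
  set SL : ℂ := ∑ F ∈ E.powerset, (F.card : ℂ)
  set SP : ℂ := ∑ F ∈ E.powerset,
    ((Literature.Probability.Percolation.pivotals C (↑F : Set α) ∩ ↑E).ncard : ℂ)
  have hN : N ≠ 0 := pow_ne_zero _ two_ne_zero
  have hSP : SP = 4 * SaL - 2 * (E.card : ℂ) * Sa := by linear_combination (-2 : ℂ) * hR'
  have hSL : SL = (E.card : ℂ) * N / 2 := by linear_combination h0' / 2
  rw [hSP, hSL]
  field_simp
  ring

/-- **First `s`-jet at `s = 1` of the self-dual random-cluster crossing ratio** (finite volume,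
counting form): with weights `s^(|ω| + 2 k(ω))` (`k` any `ℕ`-valued configuration functional,
in the route: the number of open clusters with the two arcs wired),
`d/ds|_{s=1} (Σ_{ω ∈ C} s^(|ω|+2k(ω))) / (Σ_ω s^(|ω|+2k(ω))) = ¼ E_{1/2}[N_piv] + 2 Cov_{1/2}(1_C, k)`,
all averages over the `2^|E|` subsets of `E` (the `|ω|`-part is Russo's formula at `p = 1/2`,
`deriv_ratio_indicator_pow_ncard_one`). (Grimmett 2006, Thm. 3.12 / (3.13)–(3.14) at `q = 1`.)
[folklore] -/
theorem deriv_ratio_indicator_pow_ncard_add_one (E : Finset α) {C : Set (Set α)}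
    (hC : IsUpperSet C) (k : Set α → ℕ) :
    deriv (fun s : ℂ ↦ (∑ᶠ ω ∈ 𝒫 (↑E : Set α), C.indicator (fun ω ↦ s ^ (ω.ncard + 2 * k ω)) ω) /
        (∑ᶠ ω ∈ 𝒫 (↑E : Set α), s ^ (ω.ncard + 2 * k ω))) 1
      = (∑ᶠ ω ∈ 𝒫 (↑E : Set α),
            ((Literature.Probability.Percolation.pivotals C ω ∩ ↑E).ncard : ℂ)) / (4 * 2 ^ E.card)
        + 2 * ((∑ᶠ ω ∈ 𝒫 (↑E : Set α), C.indicator (fun ω ↦ (k ω : ℂ)) ω) / 2 ^ E.card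
          - (∑ᶠ ω ∈ 𝒫 (↑E : Set α), C.indicator (fun _ ↦ (1 : ℂ)) ω) / 2 ^ E.card
            * ((∑ᶠ ω ∈ 𝒫 (↑E : Set α), (k ω : ℂ)) / 2 ^ E.card)) := by
  have hfun : (fun s : ℂ ↦ (∑ᶠ ω ∈ 𝒫 (↑E : Set α),
        C.indicator (fun ω ↦ s ^ (ω.ncard + 2 * k ω)) ω) /
        (∑ᶠ ω ∈ 𝒫 (↑E : Set α), s ^ (ω.ncard + 2 * k ω)))
      = fun s : ℂ ↦ (∑ F ∈ E.powerset, (if (↑F : Set α) ∈ C then (1 : ℂ) else 0) * s ^ (F.card + 2 * k ↑F)) /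
          (∑ F ∈ E.powerset, s ^ (F.card + 2 * k ↑F)) := by
    funext s
    rw [finsum_mem_powerset_coe_eq_sum, finsum_mem_powerset_coe_eq_sum]
    congr 1
    · refine Finset.sum_congr rfl fun F _ ↦ ?_
      by_cases h : (↑F : Set α) ∈ C
      · simp [h, Set.ncard_coe_finset]
      · simp [h]
    · exact Finset.sum_congr rfl fun F _ ↦ by rw [Set.ncard_coe_finset]
  rw [hfun, deriv_sum_mul_pow_div_sum_pow_one E.powerset ⟨∅, Finset.empty_mem_powerset E⟩
    (fun F ↦ (if (↑F : Set α) ∈ C then (1 : ℂ) else 0)) (fun F ↦ F.card + 2 * k ↑F), finsum_mem_powerset_coe_eq_sum,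
    finsum_mem_powerset_coe_eq_sum, finsum_mem_powerset_coe_eq_sum,
    finsum_mem_powerset_coe_eq_sum, Finset.card_powerset]
  have hR := sum_powerset_ite_mem_mul_eq_half_sum_ncard_pivotals hC E
  have h0 := sum_two_mul_card_sub_card E
  have hR' : 2 * (∑ F ∈ E.powerset, (if (↑F : Set α) ∈ C then (1 : ℂ) else 0) * (F.card : ℂ))
      - (E.card : ℂ) * ∑ F ∈ E.powerset, (if (↑F : Set α) ∈ C then (1 : ℂ) else 0)
      = (1 / 2 : ℂ) * ∑ F ∈ E.powerset,
          ((Literature.Probability.Percolation.pivotals C (↑F : Set α) ∩ ↑E).ncard : ℂ) := by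
    rw [← hR, Finset.mul_sum, Finset.mul_sum, ← Finset.sum_sub_distrib]
    exact Finset.sum_congr rfl fun F _ ↦ by ring
  have h0' : 2 * (∑ F ∈ E.powerset, (F.card : ℂ)) - (E.card : ℂ) * (2 : ℂ) ^ E.card = 0 := by
    rw [← h0, Finset.sum_sub_distrib, Finset.sum_const, Finset.card_powerset, Finset.mul_sum,
      nsmul_eq_mul]
    push_cast
    ring
  have hind1 : ∀ F : Finset α, C.indicator (fun _ ↦ (1 : ℂ)) ↑F = (if (↑F : Set α) ∈ C then (1 : ℂ) else 0) := fun F ↦ by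
    by_cases h : (↑F : Set α) ∈ C
    · simp [h]
    · simp [h]
  have hindk : ∀ F : Finset α, C.indicator (fun ω ↦ (k ω : ℂ)) ↑F = (if (↑F : Set α) ∈ C then (1 : ℂ) else 0) * k ↑F :=
      fun F ↦ by
    by_cases h : (↑F : Set α) ∈ C
    · simp [h]
    · simp [h]
  -- split the exponent sums
  have hsplit1 : ∑ F ∈ E.powerset, (if (↑F : Set α) ∈ C then (1 : ℂ) else 0) * ((F.card + 2 * k ↑F : ℕ) : ℂ)
      = ∑ F ∈ E.powerset, (if (↑F : Set α) ∈ C then (1 : ℂ) else 0) * (F.card : ℂ) + 2 * ∑ F ∈ E.powerset, (if (↑F : Set α) ∈ C then (1 : ℂ) else 0) * k ↑F := by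
    rw [Finset.mul_sum, ← Finset.sum_add_distrib]
    exact Finset.sum_congr rfl fun F _ ↦ by push_cast; ring
  have hsplit2 : ∑ F ∈ E.powerset, ((F.card + 2 * k ↑F : ℕ) : ℂ)
      = ∑ F ∈ E.powerset, (F.card : ℂ) + 2 * ∑ F ∈ E.powerset, (k ↑F : ℂ) := by
    rw [Finset.mul_sum, ← Finset.sum_add_distrib]
    exact Finset.sum_congr rfl fun F _ ↦ by push_cast; ring
  simp only [hind1, hindk]
  rw [hsplit1, hsplit2]
  push_cast
  set N : ℂ := (2 : ℂ) ^ E.card with hNdef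
  set Sa : ℂ := ∑ F ∈ E.powerset, (if (↑F : Set α) ∈ C then (1 : ℂ) else 0)
  set SaL : ℂ := ∑ F ∈ E.powerset, (if (↑F : Set α) ∈ C then (1 : ℂ) else 0) * (F.card : ℂ)
  set SL : ℂ := ∑ F ∈ E.powerset, (F.card : ℂ)
  set SP : ℂ := ∑ F ∈ E.powerset,
    ((Literature.Probability.Percolation.pivotals C (↑F : Set α) ∩ ↑E).ncard : ℂ)
  have hN : N ≠ 0 := pow_ne_zero _ two_ne_zero
  have hSP : SP = 4 * SaL - 2 * (E.card : ℂ) * Sa := by linear_combination (-2 : ℂ) * hR'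
  have hSL : SL = (E.card : ℂ) * N / 2 := by linear_combination h0' / 2
  rw [hSP, hSL]
  field_simp
  ring

end Jets

end Summit.CriticalPhenomena.CardyFormulaZ2.Theorems
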